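import Summits.QuantumFields.YangMills.Theorems.FluctuationComparisonRegPrIntLWregFibredChartReg
import HarnessLib

/-!
# PORT F2c — CHART-ALG IV (§0f of `Lines/wreg_chart.lean` v20, VERBATIM): the `descendTo` fibred chart

Cell `ym3-torus` (HUMAN RULING D-0037 — YM₃ on T³ is ladder rung R3, not the Clay problem), width seat `ym3-torus-px11` g8; count-neutral helper
(`--kind proof --supports stmt-QuantumFields-20520 --as helper`).  A PORT IS BOOKKEEPING: every declaration below is a VERBATIM move of a declaration PROVED in the
Cruxes workfile `Cruxes/FluctuationComparisonRegPrIntL/Lines/wreg_chart.lean` v20 (ideator ym-r3-idea-1 g18, LINE g18-2; 116 decls, 0 `sorry`), per the PORT MAP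
`Lines/wreg_chart_port.md` (its file F2, split at the section seams to respect the 400-line rule), so that the organ WREG becomes importable BY NAME.
Nothing new is proved; WREG is one organ of S2β; EXW ∕ GAP ∕ LAPLACE ∕ H4ᶜ ∕ LFR♯ᶜ and the package's stubs are untouched; crux stmt-QuantumFields-20520 is
NOT closed; no summit statement is proved; rung R3 = YM₃ on T³ (SU(2)) — NOT d = 4, NOT infinite volume, NOT a mass gap, NOT Clay.
References: T. Bałaban, CMP 109 (1987) 249–301 [Balaban1987RG1] ((0.4) p.253, (2.9)–(2.10) pp.266–267); A. S. Kechris, Classical Descriptive Set Theory (1995) [Kechris1995].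

THIS FILE (F2c) = §0f CHART-ALG IV (v20 ll. 1512–1740, 3 decls): `fibredLaw_transport` (transport of a fibred-chart law along a measure-preserving
relabelling), `exists_chartData_descendTo`, `exists_chartData_descendTo_reg` — the `descendTo` (level-shifted, `T3LevelShift.fieldShift`) fibred chart on any
measurable fine set inside the charted set = the fields `Φ, jac, measurable_Φ, measurable_jac, descendTo_Φ, map_Φ` (+ `T_eq`, `charted`, `recog`) of the
port's F3 `WindowChart` ∕ F5 `ChartData`.  Same namespace as F2a ∕ F2b.
-/

noncomputable section

open MeasureTheory Filter Topology Set
open scoped ENNReal NNReal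
open Literature.MathematicalPhysics.QuantumFieldTheory.Balaban1983to89
open Literature.MathematicalPhysics.QuantumFieldTheory.Balaban1983to89.T3ContinuumYM3Torus
open Literature.MathematicalPhysics.QuantumFieldTheory.Balaban1983to89.T3NestedUnitLaws
open Literature.MathematicalPhysics.QuantumFieldTheory.Balaban1983to89.T3UnitLawDensityEML
open Literature.MathematicalPhysics.QuantumFieldTheory.Balaban1983to89.T3UnitScaleTilt
open Literature.MathematicalPhysics.QuantumFieldTheory.Balaban1983to89.T3TiltDescent
open Literature.MathematicalPhysics.QuantumFieldTheory.Balaban1983to89.T3PrintedRegularMinimiser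
open Literature.MathematicalPhysics.QuantumFieldTheory.Balaban1983to89.T3ConstrainedMinimiser (fibre)
open Literature.MathematicalPhysics.QuantumFieldTheory.Balaban1983to89.T3LevelShift
open Literature.MathematicalPhysics.QuantumFieldTheory.Balaban1983to89.Missing
open Literature.MathematicalPhysics.QuantumFieldTheory.Balaban1983to89.T4Continuum
open scoped Literature.MathematicalPhysics.QuantumFieldTheory.Balaban1983to89.T3OrbitAverage

namespace Summit.QuantumFields.YangMills.Theorems.FluctuationComparisonRegPrIntLWregFibredChart

open Summit.QuantumFields.YangMills.Theorems.FluctuationComparisonRegPrIntLWregChain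

section ChainLawSec

open Function
open Literature.MathematicalPhysics.QuantumFieldTheory.Balaban1983to89.BlockAveraging (Idx avgFun measurable_avgFun)
open Literature.MathematicalPhysics.QuantumFieldTheory.Balaban1983to89.BlockAveragingHaarAC (centralBond centralBond_injective isLocal_avgFun pre post)
open Literature.MathematicalPhysics.QuantumFieldTheory.Balaban1983to89.BlockAveragingEMLHaarAC (fibreFamily offCard)
open Literature.MathematicalPhysics.QuantumFieldTheory.Balaban1983to89.ExpMeanLog (expMeanLogSU deltaSU deltaSU_pos measurable_expMeanLogSU_E)
open Literature.MathematicalPhysics.QuantumFieldTheory.Balaban1983to89.Node00 (SU)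
open Summit.QuantumFields.YangMills.BalabanUVNodes.N09CentralWindowAtRecord (avgFun_update_centralBond_injOn_centralWindow mem_injWindow_of_mem_centralWindow)
open Summit.QuantumFields.YangMills.BalabanUVNodes.N09CentralWindowForwardLaw (isClosed_centralWindowW)
open Summit.QuantumFields.YangMills.BalabanUVNodes.N09CentralWindowForwardLawAtRecord (exists_jacobian_forwardLaws_continuousOn)
open Summit.QuantumFields.YangMills.BalabanUVNodes.N07AveragingLocalContinuity (continuousAt_avgFun_apply_of_small)
open Summit.QuantumFields.YangMills.BalabanUVNodes.N09CentralWindowInverseContinuous (isClosed_centralWindow)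
open Literature.Topology.ParametricInverse (continuousOn_of_isClosed_graph)

variable {P : Params}

/-! ## §0f CHART-ALG IV: the `descendTo` (level-shifted) fibred chart on any measurable fine set inside the charted set. -/

section Descend

open Literature.MathematicalPhysics.QuantumFieldTheory.Balaban1983to89.T3ContinuumYM3Torus
open Literature.MathematicalPhysics.QuantumFieldTheory.Balaban1983to89.T3LevelShift
open Literature.MathematicalPhysics.QuantumFieldTheory.Balaban1983to89.T3TiltDescent
open Filter Topology

variable {N : ℕ} [NeZero N]

/-- Transport of a fibred-chart law along a measure-preserving relabelling of the coarse variable with a left inverse, … -/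
theorem fibredLaw_transport {X Y Y' : Type*} [MeasurableSpace X] [MeasurableSpace Y] [MeasurableSpace Y']
    (μX : Measure X) (μY : Measure Y) (μY' : Measure Y') [SFinite μX] [SFinite μY] [SFinite μY']
    {A : X → Y} {e : Y → Y'} {e' : Y' → Y} (he : Measurable e) (he' : Measurable e')
    (he'e : ∀ y, e' (e y) = y) (hpres : μY.map e = μY')
    {S : Set X} {Φ : Y × X → X} {Jac : Y × X → ℝ≥0∞} (hΦ : Measurable Φ) (hJac : Measurable Jac)
    (hlaw : ∀ U₀ : Set Y, MeasurableSet U₀ → μX.restrict (A ⁻¹' U₀ ∩ S) = ((((μY.restrict U₀).prod μX).withDensity Jac).map Φ))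
    {S' : Set X} (hS' : MeasurableSet S') (hsub : S' ⊆ S) {O : Set Y'} (hO : MeasurableSet O) :
    μX.restrict ((e ∘ A) ⁻¹' O ∩ S') =
      ((((μY'.restrict O).prod μX).withDensity fun p => S'.indicator 1 (Φ (e' p.1, p.2)) * Jac (e' p.1, p.2)).map fun p => Φ (e' p.1, p.2)) := by
  have hU₀ : MeasurableSet (e ⁻¹' O) := he hO
  have h1 : μX.restrict ((e ∘ A) ⁻¹' O ∩ S') = (μX.restrict (A ⁻¹' (e ⁻¹' O) ∩ S)).restrict S' := by
    rw [Measure.restrict_restrict hS', Set.preimage_comp]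
    congr 1
    ext x; constructor
    · rintro ⟨hx, hS⟩; exact ⟨hS, hx, hsub hS⟩
    · rintro ⟨hS, hx, -⟩; exact ⟨hx, hS⟩
  rw [h1, hlaw _ hU₀, Measure.restrict_map hΦ hS']
  have h2 : μY.restrict (e ⁻¹' O) = (μY'.restrict O).map e' := by
    rw [← hpres, Measure.restrict_map he hO, Measure.map_map he' he]
    have : e' ∘ e = id := funext he'e
    rw [this, Measure.map_id]
  have hθ : Measurable fun p : Y' × X => ((e' p.1, p.2) : Y × X) := (he'.comp measurable_fst).prodMk measurable_snd
  have h3 : ((μY'.restrict O).map e').prod μX = ((μY'.restrict O).prod μX).map fun p : Y' × X => ((e' p.1, p.2) : Y × X) := by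
    rw [show (fun p : Y' × X => ((e' p.1, p.2) : Y × X)) = Prod.map e' id from rfl, ← Measure.map_prod_map _ _ he' measurable_id,
      Measure.map_id]
  have h4 : (((μY'.restrict O).prod μX).map fun p : Y' × X => ((e' p.1, p.2) : Y × X)).withDensity Jac =
      (((μY'.restrict O).prod μX).withDensity fun p => Jac (e' p.1, p.2)).map fun p : Y' × X => ((e' p.1, p.2) : Y × X) :=
    withDensity_map_eq_map_withDensity_comp _ hθ hJac
  have hind : Measurable fun p : Y' × X => S'.indicator (1 : X → ℝ≥0∞) (Φ (e' p.1, p.2)) :=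
    (measurable_one.indicator hS').comp (hΦ.comp hθ)
  have hind_eq : ((fun p : Y' × X => ((e' p.1, p.2) : Y × X)) ⁻¹' (Φ ⁻¹' S')).indicator (1 : Y' × X → ℝ≥0∞) =
      fun p : Y' × X => S'.indicator (1 : X → ℝ≥0∞) (Φ (e' p.1, p.2)) := by
    funext p
    by_cases hp : Φ (e' p.1, p.2) ∈ S'
    · rw [Set.indicator_of_mem (show p ∈ (fun p : Y' × X => ((e' p.1, p.2) : Y × X)) ⁻¹' (Φ ⁻¹' S') from hp), Set.indicator_of_mem hp]
      rfl
    · rw [Set.indicator_of_notMem (show p ∉ (fun p : Y' × X => ((e' p.1, p.2) : Y × X)) ⁻¹' (Φ ⁻¹' S') from hp),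
        Set.indicator_of_notMem hp]
  rw [h2, h3, h4, Measure.restrict_map hθ (hΦ hS'), Measure.map_map hΦ hθ, restrict_withDensity (hθ (hΦ hS')),
    ← withDensity_indicator_one (hθ (hΦ hS')), hind_eq,
    ← withDensity_mul _ hind (show Measurable fun p : Y' × X => Jac (e' p.1, p.2) from hJac.comp hθ)]
  rfl

/-- ★★★ **CHART-ALG IV**. [cite: Balaban1987RG1, (0.4)/(0.11) p.253, (2.4) p.266 and (2.10) p.267] -/
theorem exists_chartData_descendTo (F : T3Family) {J K : ℕ} (hJK : J ≤ K) {α : ℝ} (hα0 : 0 ≤ α) (hα24 : α ≤ 1 / 24)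
    (hα64 : 64 * α ≤ deltaSU (Fin N)) (hαL : 157 * α < (((F.P K).L : ℝ) ^ ((F.P K).d - 1))⁻¹)
    (hgap : ∀ j (c : PBond (F.P K) (j + 1)), (offCard c : ℝ) / (Fintype.card (Idx (F.P K)) : ℝ) + 150 * α < 1)
    {Sfine : Set (GaugeField (F.P K) 0 (SU N))} (hSm : MeasurableSet Sfine)
    (hSsub : Sfine ⊆ {U | ∀ c, U (iterCentralBond (K - J) c) ∈ chainWindow α (K - J) U c}) :
    ∃ (Φ : GaugeField (F.P J) 0 (SU N) × GaugeField (F.P K) 0 (SU N) → GaugeField (F.P K) 0 (SU N))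
      (jac : GaugeField (F.P J) 0 (SU N) × GaugeField (F.P K) 0 (SU N) → ℝ≥0∞),
      Measurable Φ ∧ Measurable jac ∧
      (∀ V z, jac (V, z) ≠ 0 → descendTo F (expMeanLogSU (n := Fin N)) J K hJK (Φ (V, z)) = V) ∧
      (∀ V z, jac (V, z) ≠ 0 → Φ (V, z) ∈ Sfine) ∧
      ∀ O : Set (GaugeField (F.P J) 0 (SU N)), MeasurableSet O →
        (fieldMeasure (F.P K) 0 (SU N)).restrict (descendTo F (expMeanLogSU (n := Fin N)) J K hJK ⁻¹' O ∩ Sfine) =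
          ((((fieldMeasure (F.P J) 0 (SU N)).restrict O).prod (fieldMeasure (F.P K) 0 (SU N))).withDensity jac).map Φ := by
  haveI : IsProbabilityMeasure (HaarData.haar (G := SU N)) := HaarData.isProb
  have hn : K - J ≤ (F.P K).m + (F.P K).K := by
    show K - J ≤ F.m + K
    omega
  obtain ⟨Φ, Jac, hΦ, hJac, hfib, hlaw⟩ := exists_fibredChart_iter (N := N) (P := F.P K) hα0 hα24 hα64 hαL hgap hn
  have hs := F.sitesPerDir_eq (m := F.m) (K := J) (j := 0) (m' := F.m) (K' := K) (j' := K - J) (by omega)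
  set e : GaugeField (F.P K) (K - J) (SU N) → GaugeField (F.P J) 0 (SU N) := fieldShift hs with he_def
  set e' : GaugeField (F.P J) 0 (SU N) → GaugeField (F.P K) (K - J) (SU N) := fieldShift hs.symm with he'_def
  have he : Measurable e := measurable_fieldShift hs
  have he' : Measurable e' := measurable_fieldShift hs.symm
  have hee' : ∀ y', e (e' y') = y' := fieldShift_symm_fieldShift hs
  have he'e : ∀ y, e' (e y) = y := fieldShift_fieldShift_symm hs
  have hpres : (fieldMeasure (F.P K) (K - J) (SU N)).map e = fieldMeasure (F.P J) 0 (SU N) := (measurePreserving_fieldShift hs).map_eq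
  have hA : Measurable (Averaging.iter (fun i => BlockAveraging.blockAvg (P := F.P K) (j := i) (expMeanLogSU (n := Fin N))) (K - J)) :=
    T4Continuum.measurable_iter _ (fun j => by rw [BlockAveraging.blockAvg_avg]; exact measurable_avgFun _ measurable_expMeanLogSU_E) _
  have hdesc : (descendTo F (expMeanLogSU (n := Fin N)) J K hJK : GaugeField (F.P K) 0 (SU N) → GaugeField (F.P J) 0 (SU N)) =
      e ∘ Averaging.iter (fun i => BlockAveraging.blockAvg (P := F.P K) (j := i) (expMeanLogSU (n := Fin N))) (K - J) := rfl
  have hJac' : Measurable fun p => (Jac p : ℝ≥0∞) := hJac.coe_nnreal_ennreal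
  have hθ : Measurable fun p : GaugeField (F.P J) 0 (SU N) × GaugeField (F.P K) 0 (SU N) =>
      ((e' p.1, p.2) : GaugeField (F.P K) (K - J) (SU N) × GaugeField (F.P K) 0 (SU N)) := (he'.comp measurable_fst).prodMk measurable_snd
  refine ⟨fun p => Φ (e' p.1, p.2), fun p => Sfine.indicator 1 (Φ (e' p.1, p.2)) * (Jac (e' p.1, p.2) : ℝ≥0∞), hΦ.comp hθ,
    ((measurable_one.indicator hSm).comp (hΦ.comp hθ)).mul (hJac'.comp hθ), fun V z hj => ?_, fun V z hj => ?_, fun O hO => ?_⟩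
  · have hJ : Jac (e' V, z) ≠ 0 := fun h => hj (by simp [h])
    rw [hdesc, Function.comp_apply, hfib _ _ hJ, hee']
  · by_contra hS
    exact hj (by simp [Set.indicator_of_notMem hS])
  · rw [hdesc]
    exact fibredLaw_transport (fieldMeasure (F.P K) 0 (SU N)) (fieldMeasure (F.P K) (K - J) (SU N)) (fieldMeasure (F.P J) 0 (SU N))
      he he' he'e hpres hΦ hJac' hlaw hSm hSsub hO

/-- ★★★ **CHART-ALG IV + CHART-REG**. [cite: Balaban1987RG1, (0.4)/(0.11) p.253, (2.4) p.266 and (2.10) p.267] -/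
theorem exists_chartData_descendTo_reg (F : T3Family) {J K : ℕ} (hJK : J ≤ K) {α : ℝ} (hα0 : 0 ≤ α) (hα24 : α ≤ 1 / 24)
    (hα64 : 64 * α ≤ deltaSU (Fin N)) (hαL : 157 * α < (((F.P K).L : ℝ) ^ ((F.P K).d - 1))⁻¹)
    (hgap : ∀ j (c : PBond (F.P K) (j + 1)), (offCard c : ℝ) / (Fintype.card (Idx (F.P K)) : ℝ) + 150 * α < 1)
    {j₀ : ℝ≥0} (hvol : j₀ = 0 ∨ ChainVol (F.P K) N α j₀)
    {Sfine : Set (GaugeField (F.P K) 0 (SU N))} (hSm : MeasurableSet Sfine)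
    (hSsub : Sfine ⊆ {U | ∀ c, U (iterCentralBond (K - J) c) ∈ chainWindow α (K - J) U c}) :
    ∃ (Φ : GaugeField (F.P J) 0 (SU N) × GaugeField (F.P K) 0 (SU N) → GaugeField (F.P K) 0 (SU N))
      (jac : GaugeField (F.P J) 0 (SU N) × GaugeField (F.P K) 0 (SU N) → ℝ≥0)
      (T : PBond (F.P K) (K - J) → GaugeField (F.P K) 0 (SU N) → Set (SU N)) (w : PBond (F.P K) (K - J) → PBond (F.P J) 0),
      Measurable Φ ∧ Measurable jac ∧
      (∀ V z, jac (V, z) ≠ 0 → descendTo F (expMeanLogSU (n := Fin N)) J K hJK (Φ (V, z)) = V) ∧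
      (∀ V z, jac (V, z) ≠ 0 → Φ (V, z) ∈ Sfine) ∧
      (∀ O : Set (GaugeField (F.P J) 0 (SU N)), MeasurableSet O →
        (fieldMeasure (F.P K) 0 (SU N)).restrict (descendTo F (expMeanLogSU (n := Fin N)) J K hJK ⁻¹' O ∩ Sfine) =
          ((((fieldMeasure (F.P J) 0 (SU N)).restrict O).prod (fieldMeasure (F.P K) 0 (SU N))).withDensity fun p => (jac p : ℝ≥0∞)).map Φ) ∧
      (∀ c z, IsClosed (T c z)) ∧
      (∀ V z, jac (V, z) ≠ 0 ↔ (∀ c, V (w c) ∈ T c z) ∧ Φ (V, z) ∈ Sfine) ∧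
      (∀ V₀ z, (∀ c, V₀ (w c) ∈ interior (T c z)) → Φ (V₀, z) ∉ frontier Sfine →
        ContinuousAt (fun V => Φ (V, z)) V₀ ∧ ContinuousAt (fun V => jac (V, z)) V₀) ∧
      (∀ V₀ z, (∃ c, V₀ (w c) ∉ closure (T c z)) → ∀ᶠ V in 𝓝 V₀, jac (V, z) = 0) ∧
      (∀ c z, T c z = chainMap (expMeanLogSU (n := Fin N)) (K - J) z c '' chainWindow α (K - J) z c) ∧
      (∀ V z, (∀ c, V (w c) ∈ T c z) → (∀ b, (∀ c, iterCentralBond (K - J) c ≠ b) → Φ (V, z) b = z b) ∧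
        (∀ c, Φ (V, z) (iterCentralBond (K - J) c) ∈ chainWindow α (K - J) (Φ (V, z)) c) ∧
        descendTo F (expMeanLogSU (n := Fin N)) J K hJK (Φ (V, z)) = V) ∧
      (∀ p, j₀ ^ ((K - J) * Fintype.card (PBond (F.P K) (K - J))) * jac p ≤ 1) ∧
      (∀ V z (g : PBond (F.P K) (K - J) → SU N), (∀ c, g c ∈ chainWindow α (K - J) z c) →
        extend (iterCentralBond (K - J)) g z ∈ Sfine →
        descendTo F (expMeanLogSU (n := Fin N)) J K hJK (extend (iterCentralBond (K - J)) g z) = V →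
        jac (V, z) ≠ 0 ∧ Φ (V, z) = extend (iterCentralBond (K - J)) g z) := by
  haveI : IsProbabilityMeasure (HaarData.haar (G := SU N)) := HaarData.isProb
  have hn : K - J ≤ (F.P K).m + (F.P K).K := by
    show K - J ≤ F.m + K
    omega
  obtain ⟨Φ, Jac, T, hΦ, hJac, hfib, hlaw, hTc, hJT, hreg, hdead, hTeq, hcharted, hbdd, hrec⟩ :=
    exists_fibredChart_iter_reg (N := N) (P := F.P K) hα0 hα24 hα64 hαL hgap hvol hn
  have hs := F.sitesPerDir_eq (m := F.m) (K := J) (j := 0) (m' := F.m) (K' := K) (j' := K - J) (by omega)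
  set e : GaugeField (F.P K) (K - J) (SU N) → GaugeField (F.P J) 0 (SU N) := fieldShift hs with he_def
  set e' : GaugeField (F.P J) 0 (SU N) → GaugeField (F.P K) (K - J) (SU N) := fieldShift hs.symm with he'_def
  have he : Measurable e := measurable_fieldShift hs
  have he' : Measurable e' := measurable_fieldShift hs.symm
  have he'c : Continuous e' := continuous_pi fun c => continuous_apply (bondShift hs.symm c)
  have hee' : ∀ y', e (e' y') = y' := fieldShift_symm_fieldShift hs
  have he'e : ∀ y, e' (e y) = y := fieldShift_fieldShift_symm hs
  have hpres : (fieldMeasure (F.P K) (K - J) (SU N)).map e = fieldMeasure (F.P J) 0 (SU N) := (measurePreserving_fieldShift hs).map_eq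
  have hdesc : (descendTo F (expMeanLogSU (n := Fin N)) J K hJK : GaugeField (F.P K) 0 (SU N) → GaugeField (F.P J) 0 (SU N)) =
      e ∘ Averaging.iter (fun i => BlockAveraging.blockAvg (P := F.P K) (j := i) (expMeanLogSU (n := Fin N))) (K - J) := rfl
  have hJac' : Measurable fun p => (Jac p : ℝ≥0∞) := hJac.coe_nnreal_ennreal
  have hθ : Measurable fun p : GaugeField (F.P J) 0 (SU N) × GaugeField (F.P K) 0 (SU N) =>
      ((e' p.1, p.2) : GaugeField (F.P K) (K - J) (SU N) × GaugeField (F.P K) 0 (SU N)) := (he'.comp measurable_fst).prodMk measurable_snd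
  set S' : Set (GaugeField (F.P J) 0 (SU N) × GaugeField (F.P K) 0 (SU N)) := {p | Φ (e' p.1, p.2) ∈ Sfine} with hS'_def
  have hS'm : MeasurableSet S' := hSm.preimage (hΦ.comp hθ)
  have hdens : (fun p : GaugeField (F.P J) 0 (SU N) × GaugeField (F.P K) 0 (SU N) =>
      Sfine.indicator 1 (Φ (e' p.1, p.2)) * (Jac (e' p.1, p.2) : ℝ≥0∞)) =
      fun p => ((S'.indicator (fun p => Jac (e' p.1, p.2)) p : ℝ≥0) : ℝ≥0∞) := by
    funext p
    by_cases hp : Φ (e' p.1, p.2) ∈ Sfine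
    · have hp' : p ∈ S' := hp
      rw [Set.indicator_of_mem hp, Set.indicator_of_mem hp', Pi.one_apply, one_mul]
    · have hp' : p ∉ S' := hp
      rw [Set.indicator_of_notMem hp, Set.indicator_of_notMem hp', zero_mul, ENNReal.coe_zero]
  have hne : ∀ V z, S'.indicator (fun p => Jac (e' p.1, p.2)) (V, z) ≠ 0 ↔ (∀ c, V (bondShift hs.symm c) ∈ T c z) ∧ Φ (e' V, z) ∈ Sfine := by
    intro V z
    constructor
    · intro h
      have hmem : (V, z) ∈ S' := Set.mem_of_indicator_ne_zero h
      refine ⟨(hJT (e' V) z).1 fun h0 => h ?_, hmem⟩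
      rw [Set.indicator_of_mem hmem, h0]
    · rintro ⟨hV, hmem⟩
      have hmem' : (V, z) ∈ S' := hmem
      rw [Set.indicator_of_mem hmem']
      exact (hJT (e' V) z).2 hV
  refine ⟨fun p => Φ (e' p.1, p.2), S'.indicator fun p => Jac (e' p.1, p.2), T, fun c => bondShift hs.symm c, hΦ.comp hθ,
    (hJac.comp hθ).indicator hS'm, fun V z hj => ?_, fun V z hj => ((hne V z).1 hj).2, fun O hO => ?_, hTc, hne,
    fun V₀ z hint hfr => ?_, fun V₀ z hout => ?_, hTeq, fun V z hV => ?charted, fun p => ?bdd, fun V z g hg hS hd => ?recog⟩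
  case charted =>
    obtain ⟨hoff, hwin⟩ := hcharted (e' V) z hV
    refine ⟨hoff, hwin, ?_⟩
    have hJ : Jac (e' V, z) ≠ 0 := (hJT (e' V) z).2 hV
    rw [hdesc, Function.comp_apply, hfib _ _ hJ, hee']
  case bdd =>
    exact (mul_le_mul' le_rfl (Set.indicator_le_self _ _ p)).trans (hbdd (e' p.1, p.2))
  case recog =>
    have h1 := hd
    rw [hdesc, Function.comp_apply] at h1
    have hiter : ∀ c, e' V c =
        Averaging.iter (fun i => BlockAveraging.blockAvg (P := F.P K) (j := i) (expMeanLogSU (n := Fin N))) (K - J)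
          (extend (iterCentralBond (K - J)) g z) c := fun c => by
      rw [← h1, he'e]
    obtain ⟨hJ, hΦg⟩ := hrec (e' V) z g hg hiter
    have hmemS' : (V, z) ∈ S' := by
      show Φ (e' V, z) ∈ Sfine
      rw [hΦg]
      exact hS
    refine ⟨?_, hΦg⟩
    show S'.indicator (fun p => Jac (e' p.1, p.2)) (V, z) ≠ 0
    rw [Set.indicator_of_mem hmemS']
    exact hJ
  · have hJ : Jac (e' V, z) ≠ 0 := (hJT (e' V) z).2 ((hne V z).1 hj).1
    rw [hdesc, Function.comp_apply, hfib _ _ hJ, hee']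
  · rw [hdesc, ← hdens]
    exact fibredLaw_transport (fieldMeasure (F.P K) 0 (SU N)) (fieldMeasure (F.P K) (K - J) (SU N)) (fieldMeasure (F.P J) 0 (SU N))
      he he' he'e hpres hΦ hJac' hlaw hSm hSsub hO
  · -- continuity at an all-interior coarse point whose leaf point is off the frontier of `Sfine`
    obtain ⟨hΦat, hJat⟩ := hreg (e' V₀) z hint
    have hΦ'at : ContinuousAt (fun V : GaugeField (F.P J) 0 (SU N) => Φ (e' V, z)) V₀ :=
      ContinuousAt.comp (f := e') (x := V₀) hΦat he'c.continuousAt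
    have hJ'at : ContinuousAt (fun V : GaugeField (F.P J) 0 (SU N) => Jac (e' V, z)) V₀ :=
      ContinuousAt.comp (f := e') (x := V₀) hJat he'c.continuousAt
    refine ⟨hΦ'at, ?_⟩
    by_cases hi : Φ (e' V₀, z) ∈ interior Sfine
    · have hev : ∀ᶠ V in 𝓝 V₀, (V, z) ∈ S' := by
        filter_upwards [hΦ'at.preimage_mem_nhds (mem_interior_iff_mem_nhds.1 hi)] with V hV
        exact hV
      refine hJ'at.congr ?_
      filter_upwards [hev] with V hV
      exact (Set.indicator_of_mem hV (fun p : GaugeField (F.P J) 0 (SU N) × GaugeField (F.P K) 0 (SU N) => Jac (e' p.1, p.2))).symm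
    · have hcl : Φ (e' V₀, z) ∉ closure Sfine := fun h => hfr ⟨h, hi⟩
      have hev : ∀ᶠ V in 𝓝 V₀, (V, z) ∉ S' := by
        filter_upwards [hΦ'at.preimage_mem_nhds (isClosed_closure.isOpen_compl.mem_nhds hcl)] with V hV
        exact fun h => hV (subset_closure h)
      refine (continuousAt_const (y := (0 : ℝ≥0))).congr ?_
      filter_upwards [hev] with V hV
      exact (Set.indicator_of_notMem hV _).symm
  · -- death near a coarse point with a pivot coordinate outside the closure of its window
    have hev : ∀ᶠ V in 𝓝 V₀, Jac (e' V, z) = 0 := he'c.continuousAt.eventually (hdead (e' V₀) z hout)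
    filter_upwards [hev] with V hV
    exact Set.indicator_apply_eq_zero.2 fun _ => hV

end Descend

end ChainLawSec

end Summit.QuantumFields.YangMills.Theorems.FluctuationComparisonRegPrIntLWregFibredChart

end
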